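import Summits.SmoothPoincare4.SmoothPoincare4.Theorems.ConvexBisectionAcyclicBisectionExistsBeltPageClause
import Summits.SmoothPoincare4.SmoothPoincare4.Theorems.ConvexBisectionAcyclicBisectionExistsBeltFramingFamilies
import HarnessLib

/-!
# Seam transport, ST3-core: the seam map of a fibred model and its inverse, on the boundary of the base
(wave 4, brick ST3-core of sub-node ST3 `node_ST3_shadowTransport` of node T3c-2 `node_seam_transport`
of stub `stub_steinRealisation` = NF6, line `modp-braid-orbits` r11, crux
`ConvexBisection.AcyclicBisectionExists`, item stmt-SmoothPoincare4-10508; registered sub-goal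
`helper_seam_fibreMap`)

Data: `X = Base g ∪_{h̄} (handles)` along a family `h` of 2-handle attaching maps on `Base g` (data
`D`), a boundary datum `bX` of `X`, the seam `Ψ : bX.carrier ≅ ∂ Base g`.  THE SEAM IS ALL OF
`∂ Base g ∖ cores`: `jA` is an open embedding, so a point `a` of the base off the cores is a
boundary point of `X` iff it is one of `Base g` (`isBoundaryPoint_jA_iff`), hence every
`a ∈ U := ∂ Base g ∖ ⋃ cores` lifts through `bX.incl` (`exists_seamLift`; the lift is continuous,
`continuous_seamLift`, and unique) and is pushed to `F a := (bBase g).incl (Ψ (lift a)) ∈ ∂ Base g`.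
Conversely a boundary point `b` of the base lifts to `(bBase g).carrier` (`exists_baseLift`), and
`b ∈ V :⇔ bX.incl (Ψ⁻¹ (lift b)) ∈ range jA`; on `V` the inverse `F⁻¹ b := jA⁻¹ (bX.incl (Ψ⁻¹ (lift b)))`
is continuous (`exists_coreLift`: `jA⁻¹` on its range).  The package `seam_fibreMap` /
`helper_seam_fibreMap` records: `F`, `F⁻¹` continuous on `U`, `V`, mutually inverse bijections
`U ≅ V ⊆ ∂ Base g`; `F a = (bBase g).incl (Ψ y)` whenever `bX.incl y = D.jA a` (the node's lifts);
under the PAGE CLAUSE `F` preserves the page angle (`w (F a) = r w a`, `r > 0`); and the points of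
`∂ Base g ∖ V` are the seam images of the DEEP BELT POINTS of `∂X` (`bX.incl y = D.jB k b'`,
`∉ range jA` — `MultiAttachmentData.cover`), which for a Lefschetz link lie in the critical extended
pages `w ∈ ℝ_{>0} · pageDir |l| k` (`helper_belt_pageClause`, V4): every NON-CRITICAL extended page
`{w ∈ ℝ_{>0} c}`, `c ∉ {pageDir |l| k}`, is contained in `V` (`seam_fibreMap_of_link`).

Everything is proved; no named facts, no `sorry`, no new definitions.  References: A. Kosinski,
*Differential Manifolds* (1993), VI §6 [Kosinski1993]; R. İ. Baykur, *Kähler decomposition of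
4-manifolds*, AGT 6 (2006), proof of Thm. 5.1 [Baykur2006].
-/

noncomputable section

set_option linter.dupNamespace false

open scoped Manifold ContDiff Topology

namespace Summit.SmoothPoincare4.SmoothPoincare4.Theorems.AcyclicBisectionExists.ModpBraidOrbits

open Set Function Filter Metric Topology
open Literature.Topology.FourManifolds Literature.Topology.FourManifolds.HandleAttachingMap
  Literature.Topology.FourManifolds.LefschetzBase

section FibreMap

variable {g : ℕ} {ι : Type} [Finite ι] {h : ι → HandleAttachingMap 3 2 (Base g)}
  {X : Type} [TopologicalSpace X] [ChartedSpace (EuclideanHalfSpace 4) X]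
  (D : MultiAttachmentData h (𝓡∂ 4) X) (bX : BoundaryData (𝓡∂ 4) X (𝓡 3))
  (Ψ : bX.carrier ≃ₘ⟮𝓡 3, 𝓡 3⟯ (bBase g).carrier)

/-! ## §1 The three lifts -/

/-- **Boundary points of the base off the cores lift through `bX.incl`** (`jA` maps them to boundary
points of `X`). [cite: Kosinski1993, VI §6] -/
theorem exists_seamLift [IsManifold (𝓡∂ 4) ∞ X] :
    ∃ Λ : ↥{a : Base g | a ∈ (𝓡∂ 4).boundary (Base g) ∧ a ∈ coresComplement h} → bX.carrier,
      ∀ a, bX.incl (Λ a) = D.jA ⟨a.1, a.2.2⟩ := by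
  have hmem : ∀ a : ↥{a : Base g | a ∈ (𝓡∂ 4).boundary (Base g) ∧ a ∈ coresComplement h},
      D.jA ⟨a.1, a.2.2⟩ ∈ range bX.incl := fun a => by
    rw [bX.range_incl]
    exact (isBoundaryPoint_jA_iff D ⟨a.1, a.2.2⟩).2 a.2.1
  choose Λ hΛ using hmem
  exact ⟨Λ, hΛ⟩

/-- Any such lift is continuous (`bX.incl` is an embedding, `bX.incl ∘ Λ = jA ∘ incl`). [folklore] -/
theorem continuous_seamLift
    {Λ : ↥{a : Base g | a ∈ (𝓡∂ 4).boundary (Base g) ∧ a ∈ coresComplement h} → bX.carrier}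
    (hΛ : ∀ a, bX.incl (Λ a) = D.jA ⟨a.1, a.2.2⟩) : Continuous Λ := by
  rw [bX.isSmoothEmbedding.isEmbedding.continuous_iff, show bX.incl ∘ Λ = fun a => D.jA ⟨a.1, a.2.2⟩
    from funext hΛ]
  exact D.hjA.isEmbedding.continuous.comp (continuous_subtype_val.subtype_mk _)

/-- **Boundary points of the base lift to the boundary carrier `(bBase g).carrier`.** [folklore] -/
theorem exists_baseLift (g : ℕ) :
    ∃ Λ' : ↥((𝓡∂ 4).boundary (Base g)) → (bBase g).carrier, ∀ b, (bBase g).incl (Λ' b) = b.1 := by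
  have hmem : ∀ b : ↥((𝓡∂ 4).boundary (Base g)), b.1 ∈ range (bBase g).incl := fun b => by
    rw [(bBase g).range_incl]; exact b.2
  choose Λ' hΛ' using hmem
  exact ⟨Λ', hΛ'⟩

/-- Any such lift is continuous. [folklore] -/
theorem continuous_baseLift {Λ' : ↥((𝓡∂ 4).boundary (Base g)) → (bBase g).carrier}
    (hΛ' : ∀ b, (bBase g).incl (Λ' b) = b.1) : Continuous Λ' := by
  rw [(bBase g).isSmoothEmbedding.isEmbedding.continuous_iff,
    show (bBase g).incl ∘ Λ' = fun b => b.1 from funext hΛ']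
  exact continuous_subtype_val

/-- **Points of `range jA` lift to `coresComplement h`**, continuously (`jA` is an embedding).
[folklore] -/
theorem exists_coreLift :
    ∃ J : ↥(range D.jA) → ↥(coresComplement h), (∀ x, D.jA (J x) = x.1) ∧ Continuous J := by
  choose J hJ using fun x : ↥(range D.jA) => x.2
  refine ⟨J, hJ, ?_⟩
  rw [D.hjA.isEmbedding.continuous_iff, show D.jA ∘ J = fun x => x.1 from funext hJ]
  exact continuous_subtype_val

/-! ## §2 The seam map and its inverse -/

/-- **The seam map of the model and its inverse on the boundary of the base** (see the file
header): continuous mutually inverse bijections `F : U ≅ V`, `U = ∂ Base g ∖ cores`, `V ⊆ ∂ Base g`,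
with `F a = (bBase g).incl (Ψ y)` whenever `bX.incl y = D.jA a`, angle-preserving under the page
clause, and `∂ Base g ∖ V` = seam images of the deep belt points. [cite: Kosinski1993, VI §6] -/
theorem seam_fibreMap [IsManifold (𝓡∂ 4) ∞ X] :
    ∃ (F Finv : Base g → Base g) (V : Set (Base g)),
      ContinuousOn F {a : Base g | a ∈ (𝓡∂ 4).boundary (Base g) ∧ a ∈ coresComplement h} ∧
      ContinuousOn Finv V ∧ V ⊆ (𝓡∂ 4).boundary (Base g) ∧
      (∀ a ∈ {a : Base g | a ∈ (𝓡∂ 4).boundary (Base g) ∧ a ∈ coresComplement h}, F a ∈ V) ∧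
      (∀ b ∈ V, Finv b ∈ {a : Base g | a ∈ (𝓡∂ 4).boundary (Base g) ∧ a ∈ coresComplement h}) ∧
      (∀ a ∈ {a : Base g | a ∈ (𝓡∂ 4).boundary (Base g) ∧ a ∈ coresComplement h}, Finv (F a) = a) ∧
      (∀ b ∈ V, F (Finv b) = b) ∧
      (∀ (a : Base g) (ha : a ∈ coresComplement h) (y : bX.carrier), bX.incl y = D.jA ⟨a, ha⟩ →
        F a = (bBase g).incl (Ψ y)) ∧
      ((∀ (y : bX.carrier) (a : ↥(coresComplement h)), bX.incl y = D.jA a →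
          ∃ c : ℝ, 0 < c ∧ w g ((bBase g).incl (Ψ y)).1 = (c : ℂ) * w g (a : Base g).1) →
        ∀ a ∈ {a : Base g | a ∈ (𝓡∂ 4).boundary (Base g) ∧ a ∈ coresComplement h},
          ∃ r : ℝ, 0 < r ∧ w g (F a).1 = (r : ℂ) * w g a.1) ∧
      (∀ b ∈ (𝓡∂ 4).boundary (Base g), b ∉ V →
        ∃ (y : bX.carrier) (k : ι) (b' : ↥(beltPiece 3 2)),
          bX.incl y = D.jB k b' ∧ bX.incl y ∉ range D.jA ∧ b = (bBase g).incl (Ψ y)) := by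
  classical
  obtain ⟨Λ, hΛ⟩ := exists_seamLift D bX
  obtain ⟨Λ', hΛ'⟩ := exists_baseLift g
  obtain ⟨J, hJ, hJc⟩ := exists_coreLift D
  have hΛc := continuous_seamLift D bX hΛ
  have hΛ'c := continuous_baseLift hΛ'
  -- uniqueness of the lifts
  have hΛu : ∀ (a : ↥{a : Base g | a ∈ (𝓡∂ 4).boundary (Base g) ∧ a ∈ coresComplement h})
      (y : bX.carrier), bX.incl y = D.jA ⟨a.1, a.2.2⟩ → y = Λ a := fun a y hy =>
    bX.injective_incl (hy.trans (hΛ a).symm)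
  have hΛ'u : ∀ (b : ↥((𝓡∂ 4).boundary (Base g))) (y : (bBase g).carrier),
      (bBase g).incl y = b.1 → y = Λ' b := fun b y hy => (bBase g).injective_incl (hy.trans (hΛ' b).symm)
  have hJu : ∀ (x : ↥(range D.jA)) (a : ↥(coresComplement h)), D.jA a = x.1 → a = J x :=
    fun x a ha => D.hjA.isEmbedding.injective (ha.trans (hJ x).symm)
  -- the sets and maps
  let U : Set (Base g) := {a : Base g | a ∈ (𝓡∂ 4).boundary (Base g) ∧ a ∈ coresComplement h}
  let V : Set (Base g) := {b | ∃ hb : b ∈ (𝓡∂ 4).boundary (Base g), bX.incl (Ψ.symm (Λ' ⟨b, hb⟩)) ∈ range D.jA}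
  let F : Base g → Base g := fun a => if ha : a ∈ U then (bBase g).incl (Ψ (Λ ⟨a, ha⟩)) else a
  let Finv : Base g → Base g := fun b =>
    if hb : b ∈ V then ((J ⟨bX.incl (Ψ.symm (Λ' ⟨b, hb.1⟩)), hb.2⟩ : ↥(coresComplement h)) : Base g) else b
  have hFU : ∀ a (ha : a ∈ U), F a = (bBase g).incl (Ψ (Λ ⟨a, ha⟩)) := fun a ha => dif_pos ha
  have hFinvV : ∀ b (hb : b ∈ V),
      Finv b = ((J ⟨bX.incl (Ψ.symm (Λ' ⟨b, hb.1⟩)), hb.2⟩ : ↥(coresComplement h)) : Base g) :=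
    fun b hb => dif_pos hb
  -- `F a` is a boundary point lifting to `Ψ (Λ a)`
  have hFb : ∀ a (ha : a ∈ U), F a ∈ (𝓡∂ 4).boundary (Base g) := fun a ha => by
    rw [hFU a ha]; exact (bBase g).incl_mem_boundary _
  have hFlift : ∀ a (ha : a ∈ U), Λ' ⟨F a, hFb a ha⟩ = Ψ (Λ ⟨a, ha⟩) := fun a ha =>
    (hΛ'u ⟨F a, hFb a ha⟩ (Ψ (Λ ⟨a, ha⟩)) (hFU a ha).symm).symm
  have hFV : ∀ a (ha : a ∈ U), F a ∈ V := fun a ha => by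
    refine ⟨hFb a ha, ?_⟩
    rw [hFlift a ha, Diffeomorph.symm_apply_apply, hΛ]
    exact mem_range_self _
  refine ⟨F, Finv, V, ?_, ?_, fun b hb => hb.1, hFV, fun b hb => ?_, fun a ha => ?_, fun b hb => ?_,
    fun a ha y hy => ?_, fun hpage a ha => ?_, fun b hb hbV => ?_⟩
  · -- continuity of `F` on `U`
    rw [continuousOn_iff_continuous_restrict]
    have e : U.restrict F = fun a : ↥U => (bBase g).incl (Ψ (Λ a)) := funext fun a => hFU a.1 a.2
    rw [e]
    exact (bBase g).continuous_incl.comp (Ψ.continuous.comp hΛc)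
  · -- continuity of `F⁻¹` on `V`
    rw [continuousOn_iff_continuous_restrict]
    have e : V.restrict Finv = fun b : ↥V =>
        ((J ⟨bX.incl (Ψ.symm (Λ' ⟨b.1, b.2.1⟩)), b.2.2⟩ : ↥(coresComplement h)) : Base g) :=
      funext fun b => hFinvV b.1 b.2
    rw [e]
    have h1 : Continuous fun b : ↥V => bX.incl (Ψ.symm (Λ' ⟨b.1, b.2.1⟩)) :=
      bX.continuous_incl.comp (Ψ.symm.continuous.comp (hΛ'c.comp (continuous_subtype_val.subtype_mk _)))
    exact continuous_subtype_val.comp (hJc.comp (h1.subtype_mk _))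
  · -- `F⁻¹ b ∈ U`
    rw [hFinvV b hb]
    refine ⟨?_, (J _).2⟩
    have h1 := (isBoundaryPoint_jA_iff D (J ⟨bX.incl (Ψ.symm (Λ' ⟨b, hb.1⟩)), hb.2⟩)).1
    rw [hJ] at h1
    exact h1 (bX.incl_mem_boundary _)
  · -- `F⁻¹ (F a) = a`
    have hFa := hFV a ha
    rw [hFinvV _ hFa]
    have key : (⟨a, ha.2⟩ : ↥(coresComplement h)) = J ⟨bX.incl (Ψ.symm (Λ' ⟨F a, hFa.1⟩)), hFa.2⟩ := by
      apply hJu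
      show D.jA ⟨a, ha.2⟩ = bX.incl (Ψ.symm (Λ' ⟨F a, hFa.1⟩))
      rw [hFlift a ha, Diffeomorph.symm_apply_apply, hΛ]
    exact (congrArg Subtype.val key).symm
  · -- `F (F⁻¹ b) = b`
    have hb' : Finv b ∈ U := by
      rw [hFinvV b hb]
      refine ⟨?_, (J _).2⟩
      have h1 := (isBoundaryPoint_jA_iff D (J ⟨bX.incl (Ψ.symm (Λ' ⟨b, hb.1⟩)), hb.2⟩)).1
      rw [hJ] at h1
      exact h1 (bX.incl_mem_boundary _)
    rw [hFU _ hb']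
    have key : Ψ.symm (Λ' ⟨b, hb.1⟩) = Λ ⟨Finv b, hb'⟩ := by
      apply hΛu
      have e2 : (⟨(Finv b), hb'.2⟩ : ↥(coresComplement h)) = J ⟨bX.incl (Ψ.symm (Λ' ⟨b, hb.1⟩)), hb.2⟩ :=
        Subtype.ext (hFinvV b hb)
      rw [e2, hJ]
    rw [← key, Diffeomorph.apply_symm_apply, hΛ']
  · -- `F` on the node's lifts
    have haU : a ∈ U := ⟨by
      have h1 := (isBoundaryPoint_jA_iff D ⟨a, ha⟩).1
      rw [← hy] at h1
      exact h1 (bX.incl_mem_boundary y), ha⟩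
    rw [hFU a haU, ← hΛu ⟨a, haU⟩ y hy]
  · -- angle preservation under the page clause
    obtain ⟨c, hc, hw⟩ := hpage (Λ ⟨a, ha⟩) ⟨a, ha.2⟩ (hΛ ⟨a, ha⟩)
    exact ⟨c, hc, by rw [hFU a ha, hw]⟩
  · -- the complement of `V` in the boundary: deep belt points
    have hy : bX.incl (Ψ.symm (Λ' ⟨b, hb⟩)) ∉ range D.jA := fun hr => hbV ⟨hb, hr⟩
    have hcov := D.cover
    have hx : bX.incl (Ψ.symm (Λ' ⟨b, hb⟩)) ∈ range D.jA ∪ ⋃ k, range (D.jB k) := by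
      rw [hcov]; exact mem_univ _
    rcases hx with hx | hx
    · exact (hy hx).elim
    · obtain ⟨k, hk⟩ := mem_iUnion.1 hx
      obtain ⟨b'', hb''⟩ := mem_range.1 hk
      refine ⟨Ψ.symm (Λ' ⟨b, hb⟩), k, b'', hb''.symm, hy, ?_⟩
      rw [Diffeomorph.apply_symm_apply, hΛ']

end FibreMap

/-! ## §3 For a Lefschetz link with the page clause: non-critical extended pages lie in `V` -/

section Link

variable {g : ℕ} {l : List ((Fin g ⊕ Fin g → ℤ) × Bool)}
  {h : Fin l.length → HandleAttachingMap 3 2 (Base g)}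
  {X : Type} [TopologicalSpace X] [T2Space X] [SecondCountableTopology X] [CompactSpace X]
  [ChartedSpace (EuclideanHalfSpace 4) X] [IsManifold (𝓡∂ 4) ∞ X]
  (D : MultiAttachmentData h (𝓡∂ 4) X) (bX : BoundaryData (𝓡∂ 4) X (𝓡 3))
  (Ψ : bX.carrier ≃ₘ⟮𝓡 3, 𝓡 3⟯ (bBase g).carrier)

/-- **The seam map of a fibred model: package for a Lefschetz link with the page clause.**  As
`seam_fibreMap`, plus: a boundary point `b` of the base outside `V` has `w b = r · pageDir |l| k`,
`r > 0`, for some letter `k` (`helper_belt_pageClause`); hence every boundary point with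
`w b = r · c`, `r > 0`, `c` a unit direction different from all `pageDir |l| k`, lies in `V`.
[cite: Baykur2006, Thm. 5.1 (proof, p. 13)] -/
theorem seam_fibreMap_of_link (hlink : IsLefschetzLink g l h)
    (hpage : ∀ (y : bX.carrier) (a : ↥(coresComplement h)), bX.incl y = D.jA a →
      ∃ c : ℝ, 0 < c ∧ w g ((bBase g).incl (Ψ y)).1 = (c : ℂ) * w g (a : Base g).1) :
    ∃ (F Finv : Base g → Base g) (V : Set (Base g)),
      ContinuousOn F {a : Base g | a ∈ (𝓡∂ 4).boundary (Base g) ∧ a ∈ coresComplement h} ∧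
      ContinuousOn Finv V ∧ V ⊆ (𝓡∂ 4).boundary (Base g) ∧
      (∀ a ∈ {a : Base g | a ∈ (𝓡∂ 4).boundary (Base g) ∧ a ∈ coresComplement h}, F a ∈ V) ∧
      (∀ b ∈ V, Finv b ∈ {a : Base g | a ∈ (𝓡∂ 4).boundary (Base g) ∧ a ∈ coresComplement h}) ∧
      (∀ a ∈ {a : Base g | a ∈ (𝓡∂ 4).boundary (Base g) ∧ a ∈ coresComplement h}, Finv (F a) = a) ∧
      (∀ b ∈ V, F (Finv b) = b) ∧
      (∀ (a : Base g) (ha : a ∈ coresComplement h) (y : bX.carrier), bX.incl y = D.jA ⟨a, ha⟩ →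
        F a = (bBase g).incl (Ψ y)) ∧
      (∀ a ∈ {a : Base g | a ∈ (𝓡∂ 4).boundary (Base g) ∧ a ∈ coresComplement h},
        ∃ r : ℝ, 0 < r ∧ w g (F a).1 = (r : ℂ) * w g a.1) ∧
      (∀ b ∈ (𝓡∂ 4).boundary (Base g), b ∉ V →
        ∃ (k : Fin l.length) (r : ℝ), 0 < r ∧ w g b.1 = (r : ℂ) * pageDir l.length k) ∧
      (∀ (b : Base g) (c : ℂ), ‖c‖ = 1 → (∀ k : Fin l.length, c ≠ pageDir l.length k) →
        b ∈ (𝓡∂ 4).boundary (Base g) → (∃ r : ℝ, 0 < r ∧ w g b.1 = (r : ℂ) * c) → b ∈ V) := by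
  obtain ⟨F, Finv, V, hF, hFinv, hV, hFV, hFinvU, hleft, hright, hnode, hangle, hdeep⟩ :=
    seam_fibreMap D bX Ψ
  have hbelt : ∀ b ∈ (𝓡∂ 4).boundary (Base g), b ∉ V →
      ∃ (k : Fin l.length) (r : ℝ), 0 < r ∧ w g b.1 = (r : ℂ) * pageDir l.length k := by
    intro b hb hbV
    obtain ⟨y, k, b', hy, hyA, rfl⟩ := hdeep b hb hbV
    obtain ⟨c, hc, hw⟩ := helper_belt_pageClause g l X h D bX Ψ hlink hpage y k b' hy hyA
    exact ⟨k, c, hc, hw⟩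
  refine ⟨F, Finv, V, hF, hFinv, hV, hFV, hFinvU, hleft, hright, hnode, hangle hpage, hbelt,
    fun b c hc1 hcrit hb hray => ?_⟩
  by_contra hbV
  obtain ⟨k, r, hr, hw⟩ := hbelt b hb hbV
  obtain ⟨r', hr', hw'⟩ := hray
  -- `r' c = r · pageDir k` with `r, r' > 0` and both directions unit forces `c = pageDir k`
  have e : (r' : ℂ) * c = (r : ℂ) * pageDir l.length k := hw'.symm.trans hw
  have hn : r' = r := by
    have h1 := congrArg norm e
    rw [norm_mul, norm_mul, Complex.norm_real, Complex.norm_real, Real.norm_eq_abs, Real.norm_eq_abs,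
      abs_of_pos hr', abs_of_pos hr, hc1, norm_pageDir, mul_one, mul_one] at h1
    exact h1
  rw [hn] at e
  exact hcrit k (mul_left_cancel₀ (Complex.ofReal_ne_zero.2 hr.ne') e)

/-- **Sub-goal `helper_seam_fibreMap` of stub `stub_steinRealisation`** (NF6 ▸ T3 ▸ T3c-2 ▸ ST3, brick
ST3-core; wave 4, lead c5): the seam map of a fibred model (Lefschetz link + page clause) and its
inverse on the boundary of the base — continuous mutually inverse bijections
`F : ∂ Base g ∖ cores ≅ V ⊆ ∂ Base g`, `F a = (bBase g).incl (Ψ y)` whenever `bX.incl y = D.jA a`,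
angle-preserving (`w (F a) = r w a`, `r > 0`), with `∂ Base g ∖ V` inside the critical extended pages
`w ∈ ℝ_{>0} pageDir |l| k`, so that every non-critical extended page lies in `V`.
[cite: Baykur2006, Thm. 5.1 (proof, p. 13)] -/
theorem helper_seam_fibreMap : ∀ (g : ℕ) (l : List ((Fin g ⊕ Fin g → ℤ) × Bool)) (h : Fin l.length → Literature.Topology.FourManifolds.HandleAttachingMap 3 2 (Literature.Topology.FourManifolds.LefschetzBase.Base g)) (X : Type) [TopologicalSpace X] [T2Space X] [SecondCountableTopology X] [CompactSpace X] [ChartedSpace (EuclideanHalfSpace 4) X] [IsManifold (𝓡∂ 4) ∞ X] (D : Literature.Topology.FourManifolds.HandleAttachingMap.MultiAttachmentData h (𝓡∂ 4) X) (bX : Literature.Topology.FourManifolds.BoundaryData (𝓡∂ 4) X (𝓡 3)) (Ψ : bX.carrier ≃ₘ⟮𝓡 3, 𝓡 3⟯ (Literature.Topology.FourManifolds.LefschetzBase.bBase g).carrier), Literature.Topology.FourManifolds.LefschetzBase.IsLefschetzLink g l h → (∀ (y : bX.carrier) (a : ↥(Literature.Topology.FourManifolds.HandleAttachingMap.coresComplement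 h)), bX.incl y = D.jA a → ∃ c : ℝ, 0 < c ∧ Literature.Topology.FourManifolds.LefschetzBase.w g ((Literature.Topology.FourManifolds.LefschetzBase.bBase g).incl (Ψ y)).1 = (c : ℂ) * Literature.Topology.FourManifolds.LefschetzBase.w g (a : Literature.Topology.FourManifolds.LefschetzBase.Base g).1) → ∃ (F Finv : Literature.Topology.FourManifolds.LefschetzBase.Base g → Literature.Topology.FourManifolds.LefschetzBase.Base g) (V : Set (Literature.Topology.FourManifolds.LefschetzBase.Base g)), ContinuousOn F {a | a ∈ (𝓡∂ 4).boundary (Literature.Topology.FourManifolds.LefschetzBase.Base g) ∧ a ∈ Literature.Topology.FourManifolds.HandleAttachingMap.coresComplement h} ∧ ContinuousOn Finv V ∧ V ⊆ (𝓡∂ 4).boundary (Literature.Topology.FourManifolds.LefschetzBase.Base g) ∧ (∀ a ∈ {a | a ∈ (𝓡∂ 4).boundary (Literature.Topology.FourManifolds.LefschetzBase.Base g) ∧ a ∈ Literature.Topology.FourManifolds.HandleAttachingMap.coresComplement h}, F a ∈ V) ∧ (∀ b ∈ V, Finv b ∈ {a | a ∈ (𝓡∂ 4).boundary (Literature.Topology.FourManifolds.LefschetzBase.Base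 g) ∧ a ∈ Literature.Topology.FourManifolds.HandleAttachingMap.coresComplement h}) ∧ (∀ a ∈ {a | a ∈ (𝓡∂ 4).boundary (Literature.Topology.FourManifolds.LefschetzBase.Base g) ∧ a ∈ Literature.Topology.FourManifolds.HandleAttachingMap.coresComplement h}, Finv (F a) = a) ∧ (∀ b ∈ V, F (Finv b) = b) ∧ (∀ (a : Literature.Topology.FourManifolds.LefschetzBase.Base g) (ha : a ∈ Literature.Topology.FourManifolds.HandleAttachingMap.coresComplement h) (y : bX.carrier), bX.incl y = D.jA ⟨a, ha⟩ → F a = (Literature.Topology.FourManifolds.LefschetzBase.bBase g).incl (Ψ y)) ∧ (∀ a ∈ {a | a ∈ (𝓡∂ 4).boundary (Literature.Topology.FourManifolds.LefschetzBase.Base g) ∧ a ∈ Literature.Topology.FourManifolds.HandleAttachingMap.coresComplement h}, ∃ r : ℝ, 0 < r ∧ Literature.Topology.FourManifolds.LefschetzBase.w g (F a).1 = (r : ℂ) * Literature.Topology.FourManifolds.LefschetzBase.w g a.1) ∧ (∀ b ∈ (𝓡∂ 4).boundary (Literature.Topology.FourManifolds.LefschetzBase.Base g), b ∉ V → ∃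 (k : Fin l.length) (r : ℝ), 0 < r ∧ Literature.Topology.FourManifolds.LefschetzBase.w g b.1 = (r : ℂ) * Literature.Topology.FourManifolds.LefschetzBase.pageDir l.length k) ∧ (∀ (b : Literature.Topology.FourManifolds.LefschetzBase.Base g) (c : ℂ), ‖c‖ = 1 → (∀ k : Fin l.length, c ≠ Literature.Topology.FourManifolds.LefschetzBase.pageDir l.length k) → b ∈ (𝓡∂ 4).boundary (Literature.Topology.FourManifolds.LefschetzBase.Base g) → (∃ r : ℝ, 0 < r ∧ Literature.Topology.FourManifolds.LefschetzBase.w g b.1 = (r : ℂ) * c) → b ∈ V) :=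
  fun _ _ _ _ _ _ _ _ _ _ D bX Ψ hlink hpage => seam_fibreMap_of_link D bX Ψ hlink hpage

end Link

end Summit.SmoothPoincare4.SmoothPoincare4.Theorems.AcyclicBisectionExists.ModpBraidOrbits

end
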